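import Summits.CriticalPhenomena.PercolationContinuityZ3.Theorems.PercNearOneGluingNoHeavyLowerTailQuantitativeLemmaAC
import HarnessLib

/-!
# `NoHeavyLowerTail` (stmt-CriticalPhenomena-4575) — the QUANTITATIVE pre-FKG surplus margin
# (gen 8's peeling with the detachment terms kept)

Support file (`--supports stmt-CriticalPhenomena-4575`), prover `prim-ineq-gen-6` (gen 9; memo `prim-ineq-gen-6/FINDING-G9.md` §1).
No definitions, no named facts, no sorries; standard axioms.  Second of three files proving the quantitative Kozma–Nitzan inequality (Q-KN):
`…QuantitativeLemmaAC` → `…QuantitativeKNMargin` (this file) → `…QuantitativeKN`.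

With `Δ_u(X) := ∫_{u ↔ X} (F(C(u)) − F(C(c)))` (`c ∈ X` of least mean `m_c`), the gen-8 peeling (`PreFKGSurplus.preSurplus_erase_add`, tower
`CovTau.setIntegral_sub_eq_projFun`) gives for the level-form margin over a decoy list `D` and observers `(o, v)`

  `μ(D_k)·Marg_{X,D}[Δ(X)] = μ(D_k)·Marg_{X∖k, k::D}[Δ(X∖k)] + Marg[covD(G_k)] + (m_k − m_c)·μ(D_k)·Marg[c_k]`,

`D_k = {k ↮ X∖k}`, `G_k` the projected monotone functional, `c_k = μ(· ↔ k | k ↮ X∖k)`.  The middle term is `≥ 0` by CSH; gen 8 discarded the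
last one (Lemma AC: `≥ 0`).  Keeping it and bounding `Marg[c_k]` from below by the quantitative Lemma AC (`CSH.avoidConst_le_cshMarg`) gives,
by induction on `|X|`,

  `Marg_{X,D}[Δ(X)] ≥ Σ_{a ∈ X∖c} (m_a − m_c) · μ(o ↔ a | a ↮ (X ∪ D ∪ {v})∖a)`      (`PreFKGSurplus.preMargin_ge_sum_of_csh`).
[cite: KozmaNitzan2024, Conj. 4 (p. 32), Lemma 2 (p. 6)] [cite: VandenbergHaggstromKahn2005, Thm. 1.3 (p. 6), §2.1 Lemma 2.4 (p. 10)]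
-/

noncomputable section

namespace Summit.CriticalPhenomena.PercolationContinuityZ3.Theorems

open MeasureTheory Set Literature.Probability.LatticeModels Literature.Probability.Percolation
open scoped Classical
open KNPreFKG CSH

namespace PreFKGSurplus

variable {n : ℕ}

/-- **The quantitative pre-FKG surplus margin** (gen 9; the gen-8 peeling `preMargin_nonneg_of_csh` with the detachment terms kept).
Non-degenerate weights, observers `o, v`, the conditioned slack hierarchy available for every owner / avoided set / decoy list (hypothesis `hCSH`
verbatim as in `preMargin_nonneg_of_csh`).  Then for every relay set `X`, every `c ∈ X` of least mean, every decoy list `D` and every monotone `F`: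
`Marg_{X,D}[u ↦ ∫_{u↔X} (F(C u) − F(C c))] ≥ Σ_{a ∈ X∖c} (m_a − m_c) · μ(o ↔ a | a ↮ (X ∪ D ∪ {v}) ∖ a)`.
[cite: KozmaNitzan2024, Conj. 4 (p. 32), Lemma 2 (p. 6)] [cite: VandenbergHaggstromKahn2005, §2.1 Lemma 2.4 (p. 10)] -/
theorem preMargin_ge_sum_of_csh (w : Sym2 (Fin n) → unitInterval) (hw : ∀ e, 0 < w e ∧ w e < 1) (o v : Fin n)
    (hCSH : ∀ (x : Fin n) (Y : Finset (Fin n)) (D : List (Fin n)),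
      x ∉ Y → o ≠ x → v ≠ x → o ∉ Y → v ∉ Y → D.Nodup → (∀ d ∈ D, d ≠ x ∧ d ∉ Y ∧ d ≠ o ∧ d ≠ v) →
      CSHHolds w x (↑Y : Set (Fin n)) D o v) :
    ∀ (X : Finset (Fin n)) (c : Fin n) (D : List (Fin n)) (F : Set (Fin n) → ℝ),
      (∀ S S' : Set (Fin n), S ⊆ S' → F S ≤ F S') → c ∈ X →
      (∀ a ∈ X, ∫ ω, F (openCluster ω c) ∂(prodBernoulli w) ≤ ∫ ω, F (openCluster ω a) ∂(prodBernoulli w)) →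
      o ∉ X → v ∉ X → D.Nodup → (∀ d ∈ D, d ∉ X ∧ d ≠ o ∧ d ≠ v) →
      ∑ a ∈ X.erase c, ((∫ ω, F (openCluster ω a) ∂(prodBernoulli w)) - ∫ ω, F (openCluster ω c) ∂(prodBernoulli w)) *
          avoidConst w a ((((↑X : Set (Fin n)) ∪ {d | d ∈ D}) ∪ {v}) \ {a}) o ≤
      cshMarg (decoyList w (↑X : Set (Fin n)) D) (obsConst w o v ((↑X : Set (Fin n)) ∪ {d | d ∈ D})) o v
        (fun u => ∫ ω in ⋃ a ∈ X, openConn u a, (F (openCluster ω u) - F (openCluster ω c)) ∂(prodBernoulli w)) := by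
  classical
  have main : ∀ (N : ℕ) (X : Finset (Fin n)) (c : Fin n) (D : List (Fin n)) (F : Set (Fin n) → ℝ), X.card = N →
      (∀ S S' : Set (Fin n), S ⊆ S' → F S ≤ F S') → c ∈ X →
      (∀ a ∈ X, ∫ ω, F (openCluster ω c) ∂(prodBernoulli w) ≤ ∫ ω, F (openCluster ω a) ∂(prodBernoulli w)) →
      o ∉ X → v ∉ X → D.Nodup → (∀ d ∈ D, d ∉ X ∧ d ≠ o ∧ d ≠ v) →
      ∑ a ∈ X.erase c, ((∫ ω, F (openCluster ω a) ∂(prodBernoulli w)) - ∫ ω, F (openCluster ω c) ∂(prodBernoulli w)) *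
          avoidConst w a ((((↑X : Set (Fin n)) ∪ {d | d ∈ D}) ∪ {v}) \ {a}) o ≤
      cshMarg (decoyList w (↑X : Set (Fin n)) D) (obsConst w o v ((↑X : Set (Fin n)) ∪ {d | d ∈ D})) o v
        (fun u => ∫ ω in ⋃ a ∈ X, openConn u a, (F (openCluster ω u) - F (openCluster ω c)) ∂(prodBernoulli w)) := by
    intro N
    induction N using Nat.strong_induction_on with
    | _ N ih =>
    intro X c D F hN hF hcX hcmin hoX hvX hD hDX
    set μ := prodBernoulli w with hμ
    have hmeas : ∀ S : Set (BondConfig (Fin n)), MeasurableSet S := fun _ => MeasurableSet.of_discrete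
    have hint : ∀ (g : BondConfig (Fin n) → ℝ), Integrable g μ := fun g => Integrable.of_finite
    -- the pre-FKG surplus as a function of the relay set, the detachment coefficients and gaps
    set PS : Finset (Fin n) → (Fin n → ℝ) := fun Y u =>
      ∫ ω in ⋃ a ∈ Y, openConn u a, (F (openCluster ω u) - F (openCluster ω c)) ∂μ with hPS
    set φ : Fin n → ℝ := fun a => avoidConst w a ((((↑X : Set (Fin n)) ∪ {d | d ∈ D}) ∪ {v}) \ {a}) o with hφ
    set δ : Fin n → ℝ := fun a => (∫ ω, F (openCluster ω a) ∂μ) - ∫ ω, F (openCluster ω c) ∂μ with hδ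
    rcases (X.erase c).eq_empty_or_nonempty with h0 | hne
    · -- base: `X = {c}`, both sides vanish
      have hXc : X = {c} := by
        rw [← Finset.insert_erase hcX, h0]; rfl
      have hzero : PS X = fun _ => 0 := by
        funext u
        simp only [hPS, hXc]
        have hU : (⋃ a ∈ ({c} : Finset (Fin n)), (openConn u a : Set (BondConfig (Fin n)))) = openConn u c := by
          ext ω; simp
        rw [hU]
        rw [setIntegral_congr_fun (hmeas _) (g := fun _ => (0 : ℝ)) (fun ω hω => by
          show F (openCluster ω u) - F (openCluster ω c) = 0
          rw [openCluster_eq_of_reach (show (openGraph ω).Reachable u c from hω), sub_self])]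
        simp
      show ∑ a ∈ X.erase c, δ a * φ a ≤ cshMarg _ _ o v (PS X)
      rw [h0, Finset.sum_empty, hzero]
      simp only [cshMarg]
      rw [show (fun _ : Fin n => (0 : ℝ)) = (0 : Fin n → ℝ) from rfl, slForm_zero]
      simp
    -- step: peel some `k ∈ X`, `k ≠ c`
    obtain ⟨k, hk⟩ := hne
    have hkc : k ≠ c := (Finset.mem_erase.1 hk).1
    have hkX : k ∈ X := (Finset.mem_erase.1 hk).2
    set X' : Finset (Fin n) := X.erase k with hX'
    have hXcard : X'.card < N := by
      rw [hX', Finset.card_erase_of_mem hkX]; have := Finset.card_pos.2 ⟨k, hkX⟩; omega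
    have hX'X : ∀ a ∈ X', a ∈ X := fun a ha => Finset.mem_of_mem_erase ha
    have hkX' : k ∉ X' := Finset.notMem_erase k X
    have hcX' : c ∈ X' := Finset.mem_erase.2 ⟨hkc.symm, hcX⟩
    have hko : o ≠ k := fun h => hoX (h ▸ hkX)
    have hkv : v ≠ k := fun h => hvX (h ▸ hkX)
    have hkD : k ∉ D := fun h => (hDX k h).1 hkX
    have hmk : ∫ ω, F (openCluster ω c) ∂μ ≤ ∫ ω, F (openCluster ω k) ∂μ := hcmin k hkX
    -- the objects
    set Dk : Set (BondConfig (Fin n)) := {ω : BondConfig (Fin n) | ∀ a ∈ (↑X' : Set (Fin n)), ¬ (openGraph ω).Reachable k a}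
      with hDk
    set gk : BondConfig (Fin n) → ℝ := fun ω => F (openCluster ω k) - F (openCluster ω c) with hgk
    set L := decoyList w (↑X : Set (Fin n)) D with hL
    set p : ℝ := obsConst w o v ((↑X : Set (Fin n)) ∪ {d | d ∈ D}) with hp
    set ck : Fin n → ℝ := avoidConst w k (↑X' : Set (Fin n)) with hck
    set Gk : Set (Sym2 (Fin n)) → ℝ := fun K => F {z | z = k ∨ ∃ e ∈ K, z ∈ e} -
      ∫ η, F (openCluster (η \ BHK2006.barOf {k} K) c) ∂μ with hGk
    have hGk_mono : Monotone Gk := CovTau.monotone_projFun w c k F hF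
    set Tk : Fin n → ℝ := fun u => ∫ ω in Dk ∩ openConn k u, gk ω ∂μ with hTk
    set J : ℝ := ∫ ω in Dk, gk ω ∂μ with hJ
    -- positivity of the conditioning event (non-degenerate weights)
    have hempty_Dk : (∅ : BondConfig (Fin n)) ∈ Dk := by
      intro a ha h
      rw [HullPort.reachable_empty_iff] at h
      exact hkX' (h ▸ (Finset.mem_coe.1 ha))
    have hDkpos : 0 < μ.real Dk := prodBernoulli_real_pos_of_nonempty hw ⟨∅, hempty_Dk⟩
    -- set identities between the systems `(X; D)`, `(X'; k; D)` and `(X'; k :: D)`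
    have hins : insert k (↑X' : Set (Fin n)) = ↑X := by
      rw [hX', Finset.coe_erase, insert_sdiff_singleton, insert_eq_of_mem (Finset.mem_coe.2 hkX)]
    have hset2 : (↑X' : Set (Fin n)) ∪ {d | d ∈ k :: D} = (↑X : Set (Fin n)) ∪ {d | d ∈ D} := by
      ext a
      simp only [mem_union, Finset.mem_coe, hX', Finset.mem_erase, mem_setOf_eq, List.mem_cons]
      constructor
      · rintro (⟨_, ha⟩ | rfl | ha)
        · exact Or.inl ha
        · exact Or.inl hkX
        · exact Or.inr ha
      · rintro (ha | ha)
        · by_cases hak : a = k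
          · exact Or.inr (Or.inl hak)
          · exact Or.inl ⟨hak, ha⟩
        · exact Or.inr (Or.inr ha)
    have hset3 : (↑X' : Set (Fin n)) ∪ ({d | d ∈ D} ∪ {v}) = ((((↑X : Set (Fin n)) ∪ {d | d ∈ D}) ∪ {v}) \ {k}) := by
      ext a
      simp only [mem_union, Finset.mem_coe, hX', Finset.mem_erase, mem_setOf_eq, mem_sdiff, mem_singleton_iff]
      constructor
      · rintro (⟨hak, ha⟩ | ha | rfl)
        · exact ⟨Or.inl (Or.inl ha), hak⟩
        · exact ⟨Or.inl (Or.inr ha), fun h => hkD (h ▸ ha)⟩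
        · exact ⟨Or.inr rfl, hkv⟩
      · rintro ⟨(ha | ha) | ha, hak⟩
        · exact Or.inl ⟨hak, ha⟩
        · exact Or.inr (Or.inl ha)
        · exact Or.inr (Or.inr ha)
    have hcshMargin : ∀ f : Set (Sym2 (Fin n)) → ℝ,
        cshMargin w k (↑X' : Set (Fin n)) D o v f = cshMarg L p o v (covD w k (↑X' : Set (Fin n)) f) := by
      intro f
      rw [cshMargin, hins]
    have hnext : cshMarg (decoyList w (↑X' : Set (Fin n)) (k :: D)) (obsConst w o v ((↑X' : Set (Fin n)) ∪ {d | d ∈ k :: D})) o v (PS X') =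
        cshMarg L p o v (PS X') - PS X' k * cshMarg L p o v ck := by
      rw [hset2, decoyList, hins, cshMarg_cons]
    -- (1) peel `k`
    have hpeel : PS X = PS X' + Tk := by
      funext u
      rw [Pi.add_apply]
      exact preSurplus_erase_add w X F c k u hkX
    -- (2) tower: the peeled term and its total through the projected functional `Gk`
    have hDk_S : ∀ u : Fin n, Dk ∩ openConn k u =
        {ω : BondConfig (Fin n) | ¬ (openGraph ω).Reachable k c} ∩
          {ω | openEdgeCluster ω k ∈ {K : Set (Sym2 (Fin n)) |
            (∀ a ∈ X', a ≠ c → ¬ (a = k ∨ ∃ e ∈ K, a ∈ e)) ∧ (u = k ∨ ∃ e ∈ K, u ∈ e)}} := by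
      intro u; ext ω
      simp only [mem_inter_iff, hDk, mem_setOf_eq, Finset.mem_coe]
      constructor
      · rintro ⟨h1, h2⟩
        refine ⟨h1 c hcX', fun a ha _ => ?_, (reachable_iff_exists_mem_openEdgeCluster ω k u).1 h2⟩
        rw [← reachable_iff_exists_mem_openEdgeCluster]; exact h1 a ha
      · rintro ⟨h1, h2, h3⟩
        refine ⟨fun a ha => ?_, (reachable_iff_exists_mem_openEdgeCluster ω k u).2 h3⟩
        by_cases hac : a = c
        · rw [hac]; exact h1
        · rw [reachable_iff_exists_mem_openEdgeCluster]; exact h2 a ha hac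
    have hDk_0 : Dk = {ω : BondConfig (Fin n) | ¬ (openGraph ω).Reachable k c} ∩
          {ω | openEdgeCluster ω k ∈ {K : Set (Sym2 (Fin n)) | ∀ a ∈ X', a ≠ c → ¬ (a = k ∨ ∃ e ∈ K, a ∈ e)}} := by
      ext ω
      simp only [mem_inter_iff, hDk, mem_setOf_eq, Finset.mem_coe]
      constructor
      · intro h1
        refine ⟨h1 c hcX', fun a ha _ => ?_⟩
        rw [← reachable_iff_exists_mem_openEdgeCluster]; exact h1 a ha
      · rintro ⟨h1, h2⟩ a ha
        by_cases hac : a = c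
        · rw [hac]; exact h1
        · rw [reachable_iff_exists_mem_openEdgeCluster]; exact h2 a ha hac
    have towU : ∀ u : Fin n, Tk u = ∫ ω in Dk ∩ openConn k u, Gk (openEdgeCluster ω k) ∂μ := by
      intro u
      simp only [hTk, hgk]
      rw [hDk_S u]
      exact CovTau.setIntegral_sub_eq_projFun w c k F _
    have tow0 : J = ∫ ω in Dk, Gk (openEdgeCluster ω k) ∂μ := by
      simp only [hJ, hgk]
      rw [hDk_0]
      exact CovTau.setIntegral_sub_eq_projFun w c k F _
    -- the total `J = (m_k − m_c) − Δ_k(X')`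
    have hJtot : J = δ k - PS X' k := by
      have h1 := integral_add_compl (hmeas Dk) (hint gk)
      have hDkc : Dkᶜ = ⋃ a' ∈ X', (openConn k a' : Set (BondConfig (Fin n))) := by
        ext ω
        rw [mem_iUnion_openConn, mem_compl_iff, hDk]
        simp only [mem_setOf_eq, Finset.mem_coe, not_forall, not_not, exists_prop]
      have h2 : ∫ ω in Dkᶜ, gk ω ∂μ = PS X' k := by
        rw [hDkc]
      have h3 : ∫ ω, gk ω ∂μ = δ k := by
        rw [hgk, integral_sub (hint _) (hint _)]
      rw [hJ]; linarith
    -- (2') the peeled term through `covD`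
    have hTk_cov : (μ.real Dk) • Tk = covD w k (↑X' : Set (Fin n)) Gk + J • ((μ.real Dk) • ck) := by
      funext u
      simp only [Pi.add_apply, Pi.smul_apply, smul_eq_mul]
      have h2 : μ.real (Dk ∩ openConn k u) = μ.real Dk * ck u := by
        simp only [hck, avoidConst, hDk]
        rw [mul_div_cancel₀ _ (ne_of_gt hDkpos)]
      rw [towU u]
      unfold covD
      rw [← hDk, ← tow0, h2]
      ring
    -- (3) CSH for the peeled relay, functional `Gk`
    have hCSHk := hCSH k X' D hkX' hko hkv (fun h => hoX (hX'X o h)) (fun h => hvX (hX'X v h)) hD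
      (fun d hd => ⟨fun h => hkD (h ▸ hd), fun h => (hDX d hd).1 (hX'X d h), (hDX d hd).2.1, (hDX d hd).2.2⟩)
    have h3 : 0 ≤ cshMarg L p o v (covD w k (↑X' : Set (Fin n)) Gk) := by
      rw [← hcshMargin]
      exact hCSHk Gk hGk_mono
    -- (4) THE QUANTITATIVE LEMMA AC: `Marg[c_k] ≥ φ_k`
    have h4 : φ k ≤ cshMarg L p o v ck := by
      have hq := CSH.avoidConst_le_cshMarg w hw k (↑X' : Set (Fin n)) D o v (fun h => hkX' (Finset.mem_coe.1 h)) hkD hkv.symm hCSHk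
      rw [hins, hset3] at hq
      exact hq
    -- (5) the next rung by induction
    have h6 : ∑ a ∈ X'.erase c, ((∫ ω, F (openCluster ω a) ∂μ) - ∫ ω, F (openCluster ω c) ∂μ) *
          avoidConst w a ((((↑X' : Set (Fin n)) ∪ {d | d ∈ k :: D}) ∪ {v}) \ {a}) o ≤
        cshMarg (decoyList w (↑X' : Set (Fin n)) (k :: D)) (obsConst w o v ((↑X' : Set (Fin n)) ∪ {d | d ∈ k :: D})) o v (PS X') :=
      ih X'.card hXcard X' c (k :: D) F rfl hF hcX' (fun a ha => hcmin a (hX'X a ha)) (fun h => hoX (hX'X o h)) (fun h => hvX (hX'X v h))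
        (List.nodup_cons.2 ⟨hkD, hD⟩)
        (fun d hd => by
          rcases List.mem_cons.1 hd with rfl | hd
          · exact ⟨hkX', hko.symm, hkv.symm⟩
          · exact ⟨fun h => (hDX d hd).1 (hX'X d h), (hDX d hd).2.1, (hDX d hd).2.2⟩)
    rw [hset2] at h6
    -- (6) split the detachment sum at `k`
    have hsum : ∑ a ∈ X.erase c, δ a * φ a = δ k * φ k + ∑ a ∈ X'.erase c, δ a * φ a := by
      rw [hX', Finset.erase_right_comm]
      exact (Finset.add_sum_erase (X.erase c) (fun a => δ a * φ a) hk).symm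
    -- (7) assemble
    have hmain : μ.real Dk * cshMarg L p o v (PS X) =
        μ.real Dk * cshMarg L p o v (PS X') + cshMarg L p o v (covD w k (↑X' : Set (Fin n)) Gk) +
          J * μ.real Dk * cshMarg L p o v ck := by
      have e1 : μ.real Dk * cshMarg L p o v Tk =
          cshMarg L p o v (covD w k (↑X' : Set (Fin n)) Gk) + J * μ.real Dk * cshMarg L p o v ck := by
        rw [← cshMarg_smul, hTk_cov, cshMarg_add, cshMarg_smul, cshMarg_smul]; ring
      rw [hpeel, cshMarg_add, mul_add, e1]
      ring
    have hδk : 0 ≤ δ k := by simp only [hδ]; linarith [hmk]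
    have e2 : J * μ.real Dk * cshMarg L p o v ck =
        μ.real Dk * (δ k * cshMarg L p o v ck) - μ.real Dk * (PS X' k * cshMarg L p o v ck) := by
      rw [hJtot]; ring
    have e3 : μ.real Dk * cshMarg (decoyList w (↑X' : Set (Fin n)) (k :: D))
        (obsConst w o v ((↑X : Set (Fin n)) ∪ {d | d ∈ D})) o v (PS X') =
        μ.real Dk * cshMarg L p o v (PS X') - μ.real Dk * (PS X' k * cshMarg L p o v ck) := by
      rw [← hset2, hnext]; ring
    have i1 : μ.real Dk * (δ k * φ k) ≤ μ.real Dk * (δ k * cshMarg L p o v ck) :=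
      mul_le_mul_of_nonneg_left (mul_le_mul_of_nonneg_left h4 hδk) hDkpos.le
    have i2 := mul_le_mul_of_nonneg_left h6 hDkpos.le
    have hbound : μ.real Dk * (∑ a ∈ X.erase c, δ a * φ a) ≤ μ.real Dk * cshMarg L p o v (PS X) := by
      rw [hsum, mul_add]
      linarith [hmain, e2, e3, i1, i2, h3]
    show ∑ a ∈ X.erase c, δ a * φ a ≤ cshMarg L p o v (PS X)
    exact le_of_mul_le_mul_left hbound hDkpos
  intro X c D F hF hcX hcmin hoX hvX hD hDX
  exact main X.card X c D F rfl hF hcX hcmin hoX hvX hD hDX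

end PreFKGSurplus

end Summit.CriticalPhenomena.PercolationContinuityZ3.Theorems

end
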